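import Summits.NavierStokesRegularity.NavierStokesRegularity.Theorems.GaldiLiouvilleGateRecordZoomAncientStubKernelAt
import HarnessLib

/-!
# Route `GaldiLiouvilleGate`, crux `RecordZoomAncient` (stmt-NavierStokesRegularity-0894),
  line `registered` — NON-FAINT BLOW-UPS CARRY A PERSISTENT CRITICAL OSCILLATION BUMP
  (the clean kernel (K) is equivalent to the registered stub `stub_oscillationKernel`)

Lead `prover-line-stmt-NavierStokesRegularity-0894-c5-0`, 2026-08-17. Namespace
`…Theorems.RecordZoomAncient.Birth`. Notation: `E(s) = ∫⁻ |∇u(s)|²`; a level `L > 0` DOMINATES at `t` if `E ≤ L` on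
`[0, t]`; the enstrophy-normalised zoom based at `(tc, xc)` with level `L` is
`z(s, y) = (ν/L) u(tc + ν³ s/L², xc + (ν²/L) y)`. A PERSISTENT CRITICAL OSCILLATION BUMP of `u` (the datum of the r8
rung `recordZoomAncientAt_of_oscillationBump`, p166059, and the conclusion of the clean kernel (K) of
`recordZoomAncient_of_blowupCarriesBump`) consists of base times `tc n ∈ (0,T)`, point pairs `x₁ n, x₂ n` with
`‖x₁ n − x₂ n‖ ≤ R₀ν/M n`, levels `M n > 0` dominating `‖u‖` on `[0, tc n] × ℝ³` with `tc n (M n)² → ∞`, an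
oscillation `‖u(tc n, x₁ n) − u(tc n, x₂ n)‖ ≥ θ M n`, and one `D` with `∫_{B(x₁ n, Rν/M n)} |∇u(t)|² ≤ DνM n` for
`t ∈ [tc n − Sν/(M n)², tc n] ∩ [0, tc n]`, every `R, S > 0`, eventually in `n`.

* `exists_oscillationBump_of_concentratedZooms` — velocity-concentrated enstrophy-normalised zooms (base times
  `tc n`, centres `xc n`, dominating levels `L n`, `tc n (L n)² → ∞`, `‖z_n(s₀, 0)‖ ≥ θ > 0` at a rescaled time
  `s₀ < 0`) yield a persistent critical oscillation bump. Mechanism: the KNSS limit `v` of the zooms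
  (`stub_zoomLimit`, p150782) has `‖v(s₀, 0)‖ ≥ θ` and `v(s₀) ∈ L⁶(ℝ³)`, so some `y'` has `‖v(s₀, y')‖ ≤ θ/2`; by the
  pointwise convergence the zooms oscillate by `≥ θ/4` between `0` and `y'` eventually, i.e. `u` oscillates by
  `≥ (θ/4) L n/ν` between `xc n` and `xc n + (ν²/L n) y'` at the physical time `tc n + ν³ s₀/(L n)²`; the levels
  `M n = (|C|+1) L n/ν + B` (`C` the universal constant of `stub_zoomBound`, p149905, `B` a bound of `‖u‖` on
  `[0, T/2] × ℝ³` from the Tao representation `stub_taoRep`, p146992) dominate `‖u‖` on the whole past, and the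
  local enstrophy is at most the global one, `≤ L n ≤ ν M n`.
-/

noncomputable section

open Set MeasureTheory Filter Topology Function
open scoped ENNReal NNReal
open Literature.Analysis.FluidPDE

namespace Summit.NavierStokesRegularity.NavierStokesRegularity.Theorems.RecordZoomAncient.Birth

-- the problem-side namespace `Summit.NavierStokesRegularity.NavierStokesRegularity.…` (summit =
-- problem for this single-problem summit) duplicates `NavierStokesRegularity` by design
set_option linter.dupNamespace false

/-- An `L⁶` function on `ℝ³` takes values of norm `≤ ε` somewhere, for every `ε > 0` (otherwise the constant `ε`,
which is not in `L⁶` of an infinite measure space, would be dominated by it). -/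
theorem exists_norm_le_of_memLp_six {f : EuclideanSpace ℝ (Fin 3) → EuclideanSpace ℝ (Fin 3)}
    (hf : MemLp f 6 volume) {ε : ℝ} (hε : 0 < ε) : ∃ y, ‖f y‖ ≤ ε := by
  by_contra hne
  push Not at hne
  have hmono : eLpNorm (fun _ : EuclideanSpace ℝ (Fin 3) => ε) 6 volume ≤ eLpNorm f 6 volume :=
    eLpNorm_mono fun y => by
      rw [Real.norm_of_nonneg hε.le]
      exact (hne y).le
  have hconst : MemLp (fun _ : EuclideanSpace ℝ (Fin 3) => ε) 6 volume :=
    ⟨aestronglyMeasurable_const, hmono.trans_lt hf.eLpNorm_lt_top⟩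
  have h6ne : (6 : ℝ≥0∞) ≠ ∞ := by norm_num
  rcases (memLp_const_iff (by norm_num) h6ne).1 hconst with h | h
  · exact hε.ne' h
  · simp at h

/-- **Velocity-concentrated zooms yield a persistent critical oscillation bump.** For a classical solution `(u, p)`
on `ℝ³ × [0, T)`, Leray–Hopf from the rapidly decaying `u 0`: base times `tc n ∈ (0, T)`, centres `xc n`, levels
`L n > 0` dominating `E` on `[0, tc n]` with `tc n (L n)² → ∞`, and a rescaled time `s₀ < 0` with
`‖(ν/L n) u(tc n + ν³ s₀/(L n)², xc n)‖ ≥ θ > 0` for all `n`, produce a persistent critical oscillation bump of `u`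
(base times, point pairs within `R₀` velocity radii, dominating levels `M n` with `tc n (M n)² → ∞`, a `θ' M n`
oscillation, bounded local enstrophy history in velocity units). Proof: KNSS limit `v` of the zooms
(`stub_zoomLimit`), `‖v(s₀,0)‖ ≥ θ`, a point `y'` with `‖v(s₀,y')‖ ≤ θ/2` (`L⁶`), pointwise convergence at `0` and
`y'`, levels `M n = (|C|+1) L n/ν + B` from `stub_zoomBound` and the Tao representation on `[0, T/2]`, and the
global enstrophy bound `L n ≤ ν M n`. -/
theorem exists_oscillationBump_of_concentratedZooms :
    ∀ (ν T : ℝ), 0 < ν → 0 < T → ∀ (u : ℝ → EuclideanSpace ℝ (Fin 3) → EuclideanSpace ℝ (Fin 3)) (p : ℝ →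
      EuclideanSpace ℝ (Fin 3) → ℝ), IsClassicalNSSolutionOn (Set.Ico 0 T) ν 0 u p → IsLerayHopfOn T ν 0 (u 0)
      u → HasRapidSpatialDecay (u 0) → ∀ (tc : ℕ → ℝ) (xc : ℕ → EuclideanSpace ℝ (Fin 3)) (L : ℕ → ℝ) (s₀ θ :
      ℝ), s₀ < 0 → 0 < θ → (∀ n, 0 < tc n ∧ tc n < T) → (∀ n, 0 < L n) → (∀ n, ∀ t ∈ Set.Icc 0 (tc n), ∫⁻ x,
      ENNReal.ofReal (frobeniusNormSq (fderiv ℝ (u t) x)) ≤ ENNReal.ofReal (L n)) → Filter.Tendsto (fun n => tc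
      n * L n ^ 2) Filter.atTop Filter.atTop → (∀ n, θ ≤ ‖(ν / L n) • u (tc n + ν ^ 3 / L n ^ 2 * s₀) (xc n)‖) →
      ∃ (tb : ℕ → ℝ) (x₁ x₂ : ℕ → EuclideanSpace ℝ (Fin 3)) (M : ℕ → ℝ) (θ' R₀ D : ℝ), (∀ n, 0 < tb n ∧ tb n <
      T) ∧ (∀ n, 0 < M n) ∧ (∀ n, ∀ t ∈ Set.Icc 0 (tb n), ∀ x, ‖u t x‖ ≤ M n) ∧ Filter.Tendsto (fun n => tb n *
      M n ^ 2) Filter.atTop Filter.atTop ∧ 0 < θ' ∧ 0 < R₀ ∧ (∀ n, ‖x₁ n - x₂ n‖ ≤ R₀ * (ν / M n)) ∧ (∀ n, θ' *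
      M n ≤ ‖u (tb n) (x₁ n) - u (tb n) (x₂ n)‖) ∧ (∀ R S : ℝ, 0 < R → 0 < S → ∀ᶠ n in Filter.atTop, ∀ t ∈
      Set.Icc 0 (tb n), tb n - S * (ν / M n ^ 2) ≤ t → (∫⁻ y in Metric.ball (x₁ n) (R * (ν / M n)),
      ENNReal.ofReal (frobeniusNormSq (fderiv ℝ (u t) y))) ≤ ENNReal.ofReal (D * (ν * M n))) := by
  intro ν T hν hT u p hcl hLH hdec tc xc L s₀ θ hs₀ hθ htc hL hdom hpast hconc
  -- ### (0) representation, universal velocity bound, early bound on `[0, T/2]`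
  have hrep : ∀ T' ∈ Set.Ioo 0 T, ∃ P : ℝ → EuclideanSpace ℝ (Fin 3) → ℝ, IsTaoSolutionOn T' ν (u 0) u P :=
    stub_taoRep ν T hν hT u p hcl hLH hdec
  obtain ⟨C, hC⟩ := stub_zoomBound
  have hbd : ∀ n, ∀ t ∈ Set.Icc (ν ^ 3 / L n ^ 2) (tc n), ∀ x, ‖u t x‖ ≤ C * L n / ν :=
    fun n t ht x => hC ν T hν hT u p hcl hLH hdec hrep (tc n) (L n) (htc n).1 (htc n).2 (hL n) (hdom n) t ht x
  obtain ⟨P₀, hP₀⟩ := hrep (T / 2) ⟨by positivity, by linarith⟩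
  obtain ⟨B, hB0, hB⟩ := hP₀.exists_bound_velocity
  -- ### (1) the zooms and their KNSS limit
  set z : ℕ → ℝ → EuclideanSpace ℝ (Fin 3) → EuclideanSpace ℝ (Fin 3) :=
    fun n s y => (ν / L n) • u (tc n + ν ^ 3 / L n ^ 2 * s) (xc n + (ν ^ 2 / L n) • y) with hz_def
  have hz : ∀ n s y, z n s y = (ν / L n) • u (tc n + ν ^ 3 / L n ^ 2 * s) (xc n + (ν ^ 2 / L n) • y) :=
    fun n s y => rfl
  obtain ⟨φ, v, hφ, hconv, -, -, -, hL6⟩ :=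
    stub_zoomLimit ν T hν hT u p hcl hLH hdec hrep tc xc L htc hL hdom hpast C hbd z hz
  -- ### (2) the limit is `≥ θ` at `(s₀, 0)` and `≤ θ/2` somewhere on the slice `s₀`
  have hv0 : θ ≤ ‖v s₀ 0‖ := by
    refine ge_of_tendsto (hconv s₀ hs₀ 0).norm (Eventually.of_forall fun k => ?_)
    have h := hconc (φ k)
    simpa only [hz, smul_zero, add_zero] using h
  obtain ⟨y', hy'⟩ := exists_norm_le_of_memLp_six (hL6 s₀ hs₀) (half_pos hθ)
  have hgap : θ / 4 < ‖v s₀ 0 - v s₀ y'‖ := by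
    have h := norm_sub_norm_le (v s₀ 0) (v s₀ y')
    linarith
  -- ### (3) eventually: oscillation of the zooms, positivity of the shifted base time, large levels
  have hE1 : ∀ᶠ k in atTop, θ / 4 < ‖z (φ k) s₀ 0 - z (φ k) s₀ y'‖ :=
    (((hconv s₀ hs₀ 0).sub (hconv s₀ hs₀ y')).norm).eventually (lt_mem_nhds hgap)
  have hpastφ : Tendsto (fun k => tc (φ k) * L (φ k) ^ 2) atTop atTop := hpast.comp hφ.tendsto_atTop
  have hE2 : ∀ᶠ k in atTop, 0 < tc (φ k) + ν ^ 3 / L (φ k) ^ 2 * s₀ := by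
    filter_upwards [hpastφ.eventually (eventually_gt_atTop (-(ν ^ 3 * s₀)))] with k hk
    have hL2 : 0 < L (φ k) ^ 2 := pow_pos (hL _) 2
    have hLk : L (φ k) ≠ 0 := (hL _).ne'
    have h2 : tc (φ k) + ν ^ 3 / L (φ k) ^ 2 * s₀ = (tc (φ k) * L (φ k) ^ 2 + ν ^ 3 * s₀) / L (φ k) ^ 2 := by
      field_simp
    rw [h2]
    exact div_pos (by linarith) hL2
  have hLlim : Tendsto L atTop atTop := by
    have h2 : Tendsto (fun n => L n ^ 2) atTop atTop := by
      refine tendsto_atTop_mono (fun n => ?_) (hpast.atTop_div_const hT)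
      rw [div_le_iff₀ hT]
      have := (htc n).2
      nlinarith [pow_pos (hL n) 2]
    have h3 : Tendsto (fun n => Real.sqrt (L n ^ 2)) atTop atTop := Real.tendsto_sqrt_atTop.comp h2
    refine h3.congr fun n => ?_
    exact Real.sqrt_sq (hL n).le
  have hLlimφ : Tendsto (fun k => L (φ k)) atTop atTop := hLlim.comp hφ.tendsto_atTop
  have hE3 : ∀ᶠ k in atTop, B ≤ L (φ k) / ν := by
    filter_upwards [hLlimφ.eventually (eventually_ge_atTop (B * ν))] with k hk
    rwa [le_div_iff₀ hν]
  have hE4 : ∀ᶠ k in atTop, ν ^ 3 / L (φ k) ^ 2 ≤ T / 2 := by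
    have h2 : Tendsto (fun k => L (φ k) ^ 2) atTop atTop :=
      (tendsto_pow_atTop two_ne_zero).comp hLlimφ
    filter_upwards [h2.eventually (eventually_ge_atTop (ν ^ 3 / (T / 2)))] with k hk
    rw [div_le_iff₀ (pow_pos (hL _) 2)]
    rw [div_le_iff₀ (by positivity : (0 : ℝ) < T / 2)] at hk
    linarith
  obtain ⟨N, hN⟩ := eventually_atTop.1 (((hE1.and hE2).and hE3).and hE4)
  -- ### (4) the bump data along `n k = φ (k + N)`
  obtain ⟨nk, hnk⟩ : ∃ nk : ℕ → ℕ, ∀ k, nk k = φ (k + N) := ⟨_, fun k => rfl⟩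
  have hNk : ∀ k, ((θ / 4 < ‖z (nk k) s₀ 0 - z (nk k) s₀ y'‖ ∧ 0 < tc (nk k) + ν ^ 3 / L (nk k) ^ 2 * s₀) ∧
      B ≤ L (nk k) / ν) ∧ ν ^ 3 / L (nk k) ^ 2 ≤ T / 2 := fun k => by
    rw [hnk]
    exact hN (k + N) (Nat.le_add_left N k)
  obtain ⟨C', hC'⟩ : ∃ C' : ℝ, C' = |C| + 1 := ⟨_, rfl⟩
  have hC'pos : 0 < C' := by rw [hC']; positivity
  have hC'1 : 1 ≤ C' := by rw [hC']; linarith [abs_nonneg C]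
  have hCC' : C ≤ C' := by rw [hC']; exact (le_abs_self C).trans (by linarith)
  obtain ⟨tb, htb⟩ : ∃ tb : ℕ → ℝ, ∀ k, tb k = tc (nk k) + ν ^ 3 / L (nk k) ^ 2 * s₀ := ⟨_, fun k => rfl⟩
  obtain ⟨M, hM⟩ : ∃ M : ℕ → ℝ, ∀ k, M k = C' * L (nk k) / ν + B := ⟨_, fun k => rfl⟩
  obtain ⟨x₁, hx₁⟩ : ∃ x₁ : ℕ → EuclideanSpace ℝ (Fin 3), ∀ k, x₁ k = xc (nk k) := ⟨_, fun k => rfl⟩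
  obtain ⟨x₂, hx₂⟩ : ∃ x₂ : ℕ → EuclideanSpace ℝ (Fin 3), ∀ k, x₂ k = xc (nk k) + (ν ^ 2 / L (nk k)) • y' :=
    ⟨_, fun k => rfl⟩
  have hMlow : ∀ k, L (nk k) / ν ≤ M k := fun k => by
    have h1 : L (nk k) / ν ≤ C' * L (nk k) / ν := by
      rw [div_le_div_iff_of_pos_right hν]
      nlinarith [hL (nk k), hC'1]
    rw [hM]
    linarith
  have hMpos : ∀ k, 0 < M k := fun k => (div_pos (hL _) hν).trans_le (hMlow k)
  have hMup : ∀ k, M k ≤ (C' + 1) * L (nk k) / ν := fun k => by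
    have h := (hNk k).1.2
    rw [hM, add_mul, one_mul, add_div]
    linarith
  have htb_le : ∀ k, tb k ≤ tc (nk k) := fun k => by
    rw [htb]
    nlinarith [div_pos (pow_pos hν 3) (pow_pos (hL (nk k)) 2)]
  have htb_pos : ∀ k, 0 < tb k := fun k => by rw [htb]; exact (hNk k).1.1.2
  refine ⟨tb, x₁, x₂, M, θ / (4 * (C' + 1)), ‖y'‖ * (C' + 1) + 1, 1, fun k => ⟨htb_pos k,
    (htb_le k).trans_lt (htc _).2⟩, hMpos, ?_, ?_, by positivity, by positivity, ?_, ?_, ?_⟩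
  · -- domination of `‖u‖` on the whole past `[0, tb k]`
    intro k t ht x
    rcases le_or_gt (ν ^ 3 / L (nk k) ^ 2) t with hge | hlt
    · have h1 := hbd (nk k) t ⟨hge, ht.2.trans (htb_le k)⟩ x
      have h2 : C * L (nk k) / ν ≤ C' * L (nk k) / ν := by
        rw [div_le_div_iff_of_pos_right hν]
        nlinarith [hL (nk k), hCC']
      rw [hM]
      linarith
    · have ht' : t ∈ Set.Icc 0 (T / 2) := ⟨ht.1, hlt.le.trans (hNk k).2⟩
      have h1 := hB t ht' x
      have h2 := (hNk k).1.2
      have h3 : 0 ≤ C' * L (nk k) / ν := (div_pos (mul_pos hC'pos (hL _)) hν).le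
      rw [hM]
      linarith
  · -- `tb k (M k)² → ∞`
    have h1 : Tendsto (fun k => (tc (nk k) * L (nk k) ^ 2 + ν ^ 3 * s₀) / ν ^ 2) atTop atTop := by
      have h := (hpast.comp (hφ.tendsto_atTop.comp (tendsto_add_atTop_nat N)))
      have h' : Tendsto (fun k => tc (nk k) * L (nk k) ^ 2) atTop atTop := by
        refine h.congr fun k => ?_
        simp only [Function.comp, hnk]
      exact (tendsto_atTop_add_const_right _ _ h').atTop_div_const (pow_pos hν 2)
    refine tendsto_atTop_mono (fun k => ?_) h1
    have hLk := hL (nk k)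
    have heq : (tc (nk k) * L (nk k) ^ 2 + ν ^ 3 * s₀) / ν ^ 2 = tb k * (L (nk k) / ν) ^ 2 := by
      rw [htb]
      field_simp
    rw [heq]
    have h2 : (L (nk k) / ν) ^ 2 ≤ M k ^ 2 :=
      pow_le_pow_left₀ (div_pos hLk hν).le (hMlow k) 2
    exact mul_le_mul_of_nonneg_left h2 (htb_pos k).le
  · -- the pair sits within `R₀` velocity radii
    intro k
    have hLk := hL (nk k)
    have h1 : ‖x₁ k - x₂ k‖ = ν ^ 2 / L (nk k) * ‖y'‖ := by
      rw [hx₁, hx₂, sub_add_cancel_left, norm_neg, norm_smul,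
        Real.norm_of_nonneg (div_pos (pow_pos hν 2) hLk).le]
    rw [h1, ← mul_div_assoc, le_div_iff₀ (hMpos k)]
    calc ν ^ 2 / L (nk k) * ‖y'‖ * M k
        ≤ ν ^ 2 / L (nk k) * ‖y'‖ * ((C' + 1) * L (nk k) / ν) :=
          mul_le_mul_of_nonneg_left (hMup k) (by positivity)
      _ = ‖y'‖ * (C' + 1) * ν := by field_simp
      _ ≤ (‖y'‖ * (C' + 1) + 1) * ν := by nlinarith [norm_nonneg y']
  · -- the oscillation at the base time
    intro k
    have hLk := hL (nk k)
    have h1 := (hNk k).1.1.1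
    have h2 : z (nk k) s₀ 0 - z (nk k) s₀ y' = (ν / L (nk k)) • (u (tb k) (x₁ k) - u (tb k) (x₂ k)) := by
      rw [hz, hz, htb, hx₁, hx₂, smul_zero, add_zero, smul_sub]
    rw [h2, norm_smul, Real.norm_of_nonneg (div_pos hν hLk).le] at h1
    -- `θ/4 < (ν/L) ‖Δu‖`, `M ≤ (C'+1) L/ν`
    have h3 : θ / (4 * (C' + 1)) * M k ≤ θ / (4 * (C' + 1)) * ((C' + 1) * L (nk k) / ν) :=
      mul_le_mul_of_nonneg_left (hMup k) (by positivity)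
    have h4 : θ / (4 * (C' + 1)) * ((C' + 1) * L (nk k) / ν) = θ / 4 * (L (nk k) / ν) := by
      field_simp
    have h5 : θ / 4 * (L (nk k) / ν) ≤ ‖u (tb k) (x₁ k) - u (tb k) (x₂ k)‖ := by
      have hpos : 0 < L (nk k) / ν := div_pos hLk hν
      have h6 := mul_lt_mul_of_pos_right h1 hpos
      have heq : ν / L (nk k) * ‖u (tb k) (x₁ k) - u (tb k) (x₂ k)‖ * (L (nk k) / ν) =
          ‖u (tb k) (x₁ k) - u (tb k) (x₂ k)‖ := by
        field_simp
      rw [heq] at h6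
      exact h6.le
    linarith
  · -- bounded local enstrophy history: the global enstrophy `≤ L ≤ ν M`
    intro R S hR hS
    refine Eventually.of_forall fun k t ht _ => ?_
    have h1 := hdom (nk k) t ⟨ht.1, ht.2.trans (htb_le k)⟩
    refine (setLIntegral_le_lintegral _ _).trans (h1.trans (ENNReal.ofReal_le_ofReal ?_))
    rw [one_mul]
    have h2 := hMlow k
    rwa [div_le_iff₀ hν, mul_comm] at h2

end Summit.NavierStokesRegularity.NavierStokesRegularity.Theorems.RecordZoomAncient.Birth

end
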